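/-
Origin: expansion seat `planner-pub-hodgecm-mc-axioms-1-g14-0`, handover #W195 2026-08-20T15:53:55Z md5 b1b34fa4c75c (PKG 9eb5abe97588 → b1b34fa4c75c; 578 l.; MECHANICAL (iib-R) rewrite v3.1 of the PKG file as it stands (61 token edits; rules R1x2+RX[h₂']x59)) (`HOME/mc/pub-hodgecm-mc-axioms-1-g14/revendor/kit-r55/stage55/HodgeCM/Model/Binders/ArchKTypeAt.lean`, md5 b1b34fa4c75c, 578 lines);
landed by the gen-22 packager (p-g22) in gate run 55 REPLACES the earlier landed copy of `HodgeCM/Model/Binders/ArchKTypeAt.lean` (seat copy carried the packager Origin header of an earlier run (stripped)).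
-/
/-
Origin: speedrun cell pub-hodgecm, MODEL-CONSTRUCTION sub-cell, unit pub-hodgecm-mc-binder-1-g12 (BINDER PROVER, gen 12; row 17 `real34`,
residual (W-0): admissible (34) wedges with an ARBITRARY rational centre of the finite test function), seat
prover-pub-hodgecm-mc-binder-1-g12-0, 2026-08-20.  Target in PKG: HodgeCM/Model/Binders/ArchKTypeAt.lean (NEW additive leaf; imports
`Binders/Real34WedgeSpan`, `Binders/ArchKTypeHolType`, `ThetaHolContinuity`).  KERNEL ONLY: one structure (a centre-indexed copy of theta-3's
`ArchKTypeData`, data + equations, no `Prop`-valued record of a published theorem), defs, theorems; 0 records, nothing cited, 0 `def … : Prop`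
beyond the three (AN)/(REP)/(H1) predicate ABBREVIATIONS copied verbatim from `ThetaHolAssembly` / `ThetaHolDirections` at the new centre;
MODEL-N ±0, E unchanged.  Nothing here is a claim of the manuscripts under adjudication.
-/
import Summits.HodgeConjecture.HodgeCM.Model.Binders.Real34WedgeSpan
import Summits.HodgeConjecture.HodgeCM.Model.Binders.ArchKTypeHolType
import Summits.HodgeConjecture.HodgeCM.Model.ThetaHolContinuity

/-!
# Archimedean `K`-type data with an arbitrary finite-adelic CENTRE and LEVEL IDEAL, and their admissible (34) wedges

Row 17's residual after RUN 46 is (W-0) (`Binders/Real34BaseLetter`, `Real34CensusSideT.ofBase`): for every character `χ` and every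
finite index `f : FinSB L⁺ (Fin 6)` of binder-2's (34) census core, an admissible wedge sum of the guarded S pin with the `ϑ₃₄(χ, ·)`-period
of the inserted base vector `insM f φ₀`.  The supply of admissible wedges installed so far (RUN-45 #46 `Binders/Real34WedgeOfArchKType`) reads
them off theta-3's `ArchKTypeData 𝕏 k N`, whose frames are `Φ_∞(ℓ) ⊗ 1_{x₀ + N𝒪̂³}` with the FIXED rational base point `x₀ = ((𝕏).P k).x₀` of
the line datum.  Matching an arbitrary finite index `f` (the finite part of `insM f φ₀` IS `f`) needs the frames `Φ_∞(ℓ) ⊗ 1_{x + N𝒪̂³}` for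
EVERY thin coset `xc + 𝔫𝒪̂³` (these indicator functions span `FinSB L⁺ (Fin 3)`), which the `x₀`-pinned structure cannot express.
This leaf supplies the centre-indexed currency, re-using every analytic lemma of theta-3's holomorphy tower verbatim:

* § 1 `WeilPairData.archSlotTAt xc 𝔫`, `thetaArchFunₗAt`, **`IsThetaArchContinuousAt xc 𝔫`** ((H1) at the finite-adelic centre `xc` and the
  level ideal `𝔫`; at `(finEmb P.x₀, (N))` it is `IsThetaArchContinuous N` by `Iff.rfl`) and **`isThetaArchContinuousAt_of_isLFAction`**: (H1) at EVERY centre from LF-continuity of the pair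
  action (`IsLFAction`, discharged at every S-family pin: `SInstance.hLF_ROG` & co.) — the tree's `continuous_toThetaTop_repWeilThetaDatum_thinCosetTestFunₗ`
  is already stated for an arbitrary finite-adelic centre;
* § 2 **`ArchKTypeDataAt X k xc 𝔫`** — theta-3's `ArchKTypeData X k N` with `testFun … (X.P k).x₀ N = Φ ⊗ 1_{x₀ + N𝒪̂}` replaced by the
  general thin coset `thinCosetTestFunₗ xc 𝔫 Φ = Φ ⊗ 1_{xc + 𝔫𝒪̂}` (`xc` finite-adelic, `𝔫` an ideal) in (W-Kf′) `fixN` and (W-⊗′) `prodN`, and without the `φ_N`-normalisation `ℓ₀ / arch₀` (only E's `fam` needs it; wedges do not); `ArchKTypeData.toAt` embeds the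
  installed data (centre `finEmb x₀`, level `(N)`; `testFun` IS this thin coset by `rfl`); the product situation `B.situation` (one family `jFam`, `Kc = K₁ × K₂`) is SATURATED at `K_{Γ₀}` and STRICT
  exactly as `ProductKTypeData.situation` (same proofs); (AN) `IsWeaklyPDiff`, (REP) `IsPMinusKilledAlong`, (REP′) `IsWeaklyCR` and
  `isWeaklyCR_of_isPMinusKilledAlong` are the verbatim copies (they only see `ωinf`, `Φarch`);
* § 4 `ArchKTypeDataAt.castSide` (+ `_Γ₀`, `_Φarch`, (AN)/(REP) invariance): transport along `S₁ = S₂`, as `ArchKTypeData.castSide`;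
* § 3 at the pin `𝕏 = thetaSpaceInputIn … S₀ hV`: `isHolGerm_thetaFormOf`, `isHolType`, **`adm₃₄_of_isPMinusKilledAlong`** ((H1)@x + (AN) + (REP)
  along `-i e_p`), the frame equation and **`ArchKTypeDataAt.wedge_mem_admWedgeSpan_of_isPMinusKilledAlong`**: for `B₂ : ArchKTypeDataAt 𝕏 2 x₂ 𝔫₂`,
  `B₃ : ArchKTypeDataAt 𝕏 3 x₃ 𝔫₃` at a common level, the wedge `tau34 (Φ₂(e₀^∨)) (Φ₃(e₁^∨)) − tau34 (Φ₂(e₁^∨)) (Φ₃(e₀^∨))` of the frames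
  `Φₖ(ℓ) = Φ_∞,k(ℓ) ⊗ 1_{xₖ + 𝔫ₖ𝒪̂³}` lies in `admWedgeSpan … S₀ hV` — RUN-45 #46 at arbitrary thin cosets, with (H1) taken as `IsLFAction`.

So the supply side of (W-0) asks carch-1's `k = 2, 3` tower for `ArchKTypeDataAt 𝕏 k xc 𝔫` at EVERY thin coset (the indicators
`cosetIndicatorSB xc 𝔫` SPAN `FinSB`, tree `FiniteAdeleSchwartzBruhatDirectSum`; their deep-level fixing rests on the tree's
`exists_nat_forall_dvd_finCongruenceLevel_forall_cmLineRepFin₀_thinCosetTestFunₗ_eq_self`, already stated for finite-adelic centres and ideals).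
-/

set_option autoImplicit false

noncomputable section

open Filter Topology
open scoped Classical SchwartzMap NumberField
open MulAction NumberField.mixedEmbedding IsDedekindDomain
open Literature.NumberTheory.Automorphic Literature.NumberTheory.Weil1964
open Literature.NumberTheory.Automorphic.WeightForms (restrictHom IsLevelCorrected IsWeightMatched)
open Literature.AlgebraicGeometry.HodgeTheory
open Literature.AlgebraicGeometry.ShimuraVarieties
open Literature.NumberTheory.Automorphic.PicardCM
open HodgeCM.PerL34.Seesaw HodgeCM.PerL34.RationalCoset HodgeCM.PerL34.SupplyAdelic
open HodgeCM.Model.SupplyInstance HodgeCM.Model.SupplyResidual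
open HodgeCM.Model.ThetaSpace HodgeCM.Model.ArchSideTerm

namespace HodgeCM
namespace Model

/-! ## 1. (H1) at an arbitrary centre -/

namespace SupplyResidual.WeilPairData

attribute [local instance] SupplyInstance.ratModule

section Slot

variable {K L : Type} [Field K] [NumberField K] [Field L] [NumberField L] [Algebra K L] [FiniteDimensional K L]
variable {J : Type} [Fintype J] {GU : Type} [Group GU] [TopologicalSpace GU] (P : WeilPairData K L J GU)

/-- **The archimedean slot at the thin coset `xc + 𝔫𝒪̂^J`**: `Φ_∞ ↦ Φ_∞ ⊗ 1_{xc + 𝔫𝒪̂^J}` (`thinCosetTestFunₗ xc 𝔫`) read into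
the `Θ`-initial carrier of the pair's Weil datum. -/
def archSlotTAt (xc : J → FiniteAdeleRing (𝓞 K) K) (𝔫 : Ideal (𝓞 K)) : 𝓢((J → mixedSpace K), ℂ) →ₗ[ℂ] P.weilDatum.ThetaTop :=
  thinCosetTestFunₗ (K := K) (ι := J) xc 𝔫

/-- (Ported verbatim from the HodgeCMPerL package; no docstring in the source.) -/
@[simp] theorem archSlotTAt_apply (xc : J → FiniteAdeleRing (𝓞 K) K) (𝔫 : Ideal (𝓞 K)) (Φinf : 𝓢((J → mixedSpace K), ℂ)) :
    P.archSlotTAt xc 𝔫 Φinf = P.weilDatum.toThetaTop (thinCosetTestFunₗ (K := K) (ι := J) xc 𝔫 Φinf) := rfl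

/-- at `(finEmb x₀, (N))` the slot is theta-3's `archSlotT N` (`rfl`: `testFun` is that thin coset). -/
theorem archSlotTAt_x₀ (N : ℕ) : P.archSlotTAt (finEmb K J P.x₀) (Ideal.span {(N : 𝓞 K)}) = P.archSlotT N := rfl

variable [IsTopologicalGroup GU] [LocallyCompactSpace GU] [CompactSpace (GU ⧸ P.ΓU)]

/-- **The archimedean theta functional at the thin coset**: `Φ_∞ ↦ Θ̃_{Φ_∞ ⊗ 1_{xc + 𝔫𝒪̂}}(f)(y)`, `ℂ`-linear. -/
def thetaArchFunₗAt (xc : J → FiniteAdeleRing (𝓞 K) K) (𝔫 : Ideal (𝓞 K)) (f : C(relNormOneIdeles K L ⧸ relNormOneRat K L, ℂ)) (y : GU) :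
    𝓢((J → mixedSpace K), ℂ) →ₗ[ℂ] ℂ :=
  (LinearMap.proj y : (GU → ℂ) →ₗ[ℂ] ℂ) ∘ₗ
    P.kernelDatum.thetaLiftFunₗ (probHaarRelNormOneQuot K L) P.kernelDatum_thetaLinear f ∘ₗ P.archSlotTAt xc 𝔫

/-- (Ported verbatim from the HodgeCMPerL package; no docstring in the source.) -/
@[simp] theorem thetaArchFunₗAt_apply (xc : J → FiniteAdeleRing (𝓞 K) K) (𝔫 : Ideal (𝓞 K))
    (f : C(relNormOneIdeles K L ⧸ relNormOneRat K L, ℂ)) (y : GU) (Φinf : 𝓢((J → mixedSpace K), ℂ)) :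
    P.thetaArchFunₗAt xc 𝔫 f y Φinf =
      P.kernelDatum.thetaLiftFun (probHaarRelNormOneQuot K L)
        (P.weilDatum.toThetaTop (thinCosetTestFunₗ (K := K) (ι := J) xc 𝔫 Φinf)) f y :=
  rfl

/-- **(H1) at the thin coset**: the archimedean theta functionals of `P` at the test functions `Φ_∞ ⊗ 1_{xc + 𝔫𝒪̂}` are
continuous on `𝒮((J → K_∞), ℂ)`, for every weight function `f` and every `y ∈ G_U(𝔸)`. -/
def IsThetaArchContinuousAt (xc : J → FiniteAdeleRing (𝓞 K) K) (𝔫 : Ideal (𝓞 K)) : Prop :=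
  ∀ (f : C(relNormOneIdeles K L ⧸ relNormOneRat K L, ℂ)) (y : GU), Continuous (P.thetaArchFunₗAt xc 𝔫 f y)

/-- at `(finEmb x₀, (N))`, (H1) is theta-3's (H1) (`Iff.rfl`). -/
theorem isThetaArchContinuousAt_x₀_iff (N : ℕ) :
    P.IsThetaArchContinuousAt (finEmb K J P.x₀) (Ideal.span {(N : 𝓞 K)}) ↔ P.IsThetaArchContinuous N :=
  Iff.rfl

/-- (W-cont)@`x` ⇒ (H1)@`x` (the theta lift is continuous on the `Θ`-initial carrier). -/
theorem isThetaArchContinuousAt_of_continuous_archSlotTAt (xc : J → FiniteAdeleRing (𝓞 K) K) (𝔫 : Ideal (𝓞 K))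
    (h : Continuous (P.archSlotTAt xc 𝔫)) : P.IsThetaArchContinuousAt xc 𝔫 := fun f y =>
  ((continuous_eval_const (QuotientGroup.mk y⁻¹ : GU ⧸ P.ΓU)).comp
    (P.kernelDatum.continuous_thetaLift_left (probHaarRelNormOneQuot K L) f)).comp h

/-- Under (H1)@`x`, the archimedean theta functional as a continuous linear functional. -/
def thetaArchCLMAt {xc : J → FiniteAdeleRing (𝓞 K) K} {𝔫 : Ideal (𝓞 K)} (hT : P.IsThetaArchContinuousAt xc 𝔫)
    (f : C(relNormOneIdeles K L ⧸ relNormOneRat K L, ℂ)) (y : GU) : 𝓢((J → mixedSpace K), ℂ) →L[ℂ] ℂ :=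
  ⟨P.thetaArchFunₗAt xc 𝔫 f y, hT f y⟩

/-- (Ported verbatim from the HodgeCMPerL package; no docstring in the source.) -/
@[simp] theorem thetaArchCLMAt_apply {xc : J → FiniteAdeleRing (𝓞 K) K} {𝔫 : Ideal (𝓞 K)} (hT : P.IsThetaArchContinuousAt xc 𝔫)
    (f : C(relNormOneIdeles K L ⧸ relNormOneRat K L, ℂ)) (y : GU) (Φinf : 𝓢((J → mixedSpace K), ℂ)) :
    P.thetaArchCLMAt hT f y Φinf = P.thetaArchFunₗAt xc 𝔫 f y Φinf :=
  rfl

end Slot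

section LF

variable {K L : Type} [Field K] [NumberField K] [Field L] [NumberField L] [Algebra K L] [FiniteDimensional K L]
variable {GU : Type} [Group GU] [TopologicalSpace GU] {n : ℕ} (P : WeilPairData K L (Fin n) GU)

/-- **(W-cont) at every thin coset from LF-continuity** (tree `continuous_toThetaTop_repWeilThetaDatum_thinCosetTestFunₗ`, stated for an
arbitrary finite-adelic centre and level ideal). -/
theorem continuous_archSlotTAt_of_isLFAction (hLF : P.IsLFAction) (xc : Fin n → FiniteAdeleRing (𝓞 K) K) (𝔫 : Ideal (𝓞 K)) :
    Continuous (P.archSlotTAt xc 𝔫) :=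
  continuous_toThetaTop_repWeilThetaDatum_thinCosetTestFunₗ P.ω.toHomUnits
    ((P.ΓU.prod (relNormOneRat K L) : Subgroup (GU × relNormOneIdeles K L)) : Set (GU × relNormOneIdeles K L))
    P.majorants hLF xc 𝔫

variable [IsTopologicalGroup GU] [LocallyCompactSpace GU] [CompactSpace (GU ⧸ P.ΓU)]

/-- **(H1) at every thin coset from LF-continuity.** -/
theorem isThetaArchContinuousAt_of_isLFAction (hLF : P.IsLFAction) (xc : Fin n → FiniteAdeleRing (𝓞 K) K) (𝔫 : Ideal (𝓞 K)) :
    P.IsThetaArchContinuousAt xc 𝔫 :=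
  P.isThetaArchContinuousAt_of_continuous_archSlotTAt xc 𝔫 (P.continuous_archSlotTAt_of_isLFAction hLF xc 𝔫)

end LF

end SupplyResidual.WeilPairData

/-! ## 2. Archimedean `K`-type data at a centre -/

section Generic

variable {U : Universe} {Lc : CMField} {ι₁ : Lc →+* ℂ} {V : HermSpace3 Lc ι₁} {c : SeesawCtx Lc}

/-- **Archimedean `K`-type data at the thin coset `xc + 𝔫𝒪̂^J`** (`xc` a finite-adelic centre, `𝔫` a level ideal): theta-3's
`ArchKTypeData X k N` with the test function `Φ ⊗ 1_{x₀ + N𝒪̂}` of the line datum replaced by `Φ ⊗ 1_{xc + 𝔫𝒪̂}` (`thinCosetTestFunₗ xc 𝔫 Φ`)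
in the two equations that mention it — (W-Kf′) `fixN` (the finite `K`-type fixes the family) and (W-⊗′) `prodN` (the archimedean
component acts on the archimedean factor) — and without the `φ_N`-normalisation `ℓ₀`/`arch₀`. -/
structure ArchKTypeDataAt (X : ThetaSpaceInput U V c) (k : Fin 4) (xc : X.J → FiniteAdeleRing (𝓞 X.K) X.K) (𝔫 : Ideal (𝓞 X.K)) :
    Type 1 where
  /-- the level at which the situation lives -/
  Γ₀ : Level V
  /-- the finite part `K_f` of the `K`-type -/
  K₂ : Type
  [instK₂ : Group K₂]
  /-- its map to `G_U(𝔸)` -/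
  κ₂ : K₂ →* X.GU
  /-- it commutes with the archimedean component -/
  comm : ∀ (m : K₂) (g : X.G₁), Commute (κ₂ m) (X.ιinf Γ₀ g)
  /-- it absorbs the level -/
  level : ∀ δ ∈ X.Δ Γ₀, ∃ m : K₂, X.ιinf Γ₀ δ * κ₂ m ∈ (X.P k).ΓU
  /-- saturation ((Θ-sat)): every element of `K_{Γ₀}` is an index element -/
  sat : ∀ g ∈ X.KΓ Γ₀, ∃ m : K₂, κ₂ m = g
  /-- the archimedean (harmonic) family `ℓ ↦ Φ_∞(ℓ)` -/
  Φarch : Module.Dual ℂ X.W →ₗ[ℂ] 𝓢((X.J → mixedSpace X.K), ℂ)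
  /-- the archimedean Weil action of `G₁` on `𝒮((J → K_∞), ℂ)` -/
  ωinf : Representation ℂ X.G₁ 𝓢((X.J → mixedSpace X.K), ℂ)
  /-- (W-Kf′): the finite `K`-type fixes the family `Φ_∞(ℓ) ⊗ 1_{xc + 𝔫𝒪̂}` -/
  fixN : ∀ (m : K₂) (ℓ : Module.Dual ℂ X.W),
    (X.P k).ω (κ₂ m, 1) (thinCosetTestFunₗ xc 𝔫 (Φarch ℓ)) = thinCosetTestFunₗ xc 𝔫 (Φarch ℓ)
  /-- (W-⊗′): the archimedean component acts through `ωinf` on the archimedean factor -/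
  prodN : ∀ (g : X.G₁) (Φinf : 𝓢((X.J → mixedSpace X.K), ℂ)),
    (X.P k).ω (X.ιinf Γ₀ g, 1) (thinCosetTestFunₗ xc 𝔫 Φinf) = thinCosetTestFunₗ xc 𝔫 (ωinf g Φinf)
  /-- (W-K∞′): the family is `K₁`-equivariant of type `τ₁^∨` under `ωinf` -/
  harm : ∀ (u : X.K₁) (ℓ : Module.Dual ℂ X.W), ωinf (X.κ₁ u) (Φarch ℓ) = Φarch (X.τ₁.dual u ℓ)

attribute [instance] ArchKTypeDataAt.instK₂

/-- **The installed `x₀`-pinned data are data at the thin coset `finEmb x₀ + (N)𝒪̂`** (`testFun … x₀ N` is `thinCosetTestFunₗ (finEmb x₀) (N)` by `rfl`). -/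
def ArchKTypeData.toAt {X : ThetaSpaceInput U V c} {k : Fin 4} {N : ℕ} (C : ArchKTypeData X k N) :
    ArchKTypeDataAt X k (finEmb X.K X.J (X.P k).x₀) (Ideal.span {(N : 𝓞 X.K)}) where
  Γ₀ := C.Γ₀
  K₂ := C.K₂
  κ₂ := C.κ₂
  comm := C.comm
  level := C.level
  sat := C.sat
  Φarch := C.Φarch
  ωinf := C.ωinf
  fixN := C.fixN
  prodN := C.prodN
  harm := C.harm

namespace ArchKTypeDataAt

variable {X : ThetaSpaceInput U V c} {k : Fin 4} {xc : X.J → FiniteAdeleRing (𝓞 X.K) X.K} {𝔫 : Ideal (𝓞 X.K)}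
  (B : ArchKTypeDataAt X k xc 𝔫)

/-- The adelic family `ℓ ↦ Φ_∞(ℓ) ⊗ 1_{xc + 𝔫𝒪̂}`. -/
def Φfam : Module.Dual ℂ X.W →ₗ[ℂ] piSchwartzBruhat X.K X.J := thinCosetTestFunₗ xc 𝔫 ∘ₗ B.Φarch

/-- (Ported verbatim from the HodgeCMPerL package; no docstring in the source.) -/
@[simp] theorem Φfam_apply (ℓ : Module.Dual ℂ X.W) : B.Φfam ℓ = thinCosetTestFunₗ xc 𝔫 (B.Φarch ℓ) := rfl

/-- The `K`-type map `κ (u, m) := ιinf (κ₁ u) · κ₂ m`. -/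
def kappa : X.K₁ × B.K₂ →* X.GU :=
  ((X.ιinf B.Γ₀).comp X.κ₁).noncommCoprod B.κ₂ fun u m => (B.comm m (X.κ₁ u)).symm

/-- (Ported verbatim from the HodgeCMPerL package; no docstring in the source.) -/
@[simp] theorem kappa_apply (u : X.K₁) (m : B.K₂) : B.kappa (u, m) = X.ιinf B.Γ₀ (X.κ₁ u) * B.κ₂ m := rfl

/-- The weight `τ := τ₁ ∘ fst`. -/
def tau : Representation ℂ (X.K₁ × B.K₂) X.W := X.τ₁.comp (MonoidHom.fst X.K₁ B.K₂)

/-- (Ported verbatim from the HodgeCMPerL package; no docstring in the source.) -/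
@[simp] theorem tau_apply (u : X.K₁) (m : B.K₂) : B.tau (u, m) = X.τ₁ u := rfl

/-- The `K`-type `σ := τ₁^∨ ∘ fst` on `E := W^∨`. -/
def sigma : Representation ℂ (X.K₁ × B.K₂) (Module.Dual ℂ X.W) := X.τ₁.dual.comp (MonoidHom.fst X.K₁ B.K₂)

/-- (Ported verbatim from the HodgeCMPerL package; no docstring in the source.) -/
@[simp] theorem sigma_apply (u : X.K₁) (m : B.K₂) : B.sigma (u, m) = X.τ₁.dual u := rfl

/-- (Ported verbatim from the HodgeCMPerL package; no docstring in the source.) -/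
theorem tau_dual_apply (y : X.K₁ × B.K₂) (ℓ : Module.Dual ℂ X.W) : B.tau.dual y ℓ = B.sigma y ℓ := by
  obtain ⟨u, m⟩ := y
  simp [Representation.dual_apply, tau, sigma]

/-- The one test family, read on the `Θ`-initial carrier. -/
def jFam : Module.Dual ℂ X.W →ₗ[ℂ] (X.P k).weilDatum.ThetaTop := B.Φfam

/-- (Ported verbatim from the HodgeCMPerL package; no docstring in the source.) -/
theorem jFam_apply (ℓ : Module.Dual ℂ X.W) : B.jFam ℓ = (X.P k).weilDatum.toThetaTop (B.Φfam ℓ) := rfl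

/-- (W-Kf′) + (W-⊗′) + (W-K∞′) ⇒ the family intertwines `σ` with the Weil ACTION `s(κ ·, 1)` on the nose. -/
theorem act_family (y : X.K₁ × B.K₂) (ℓ : Module.Dual ℂ X.W) :
    B.jFam (B.sigma y ℓ) = (X.P k).kernelDatum.W.act ((X.P k).kernelDatum.s (B.kappa y, 1)) (B.jFam ℓ) := by
  obtain ⟨u, m⟩ := y
  change thinCosetTestFunₗ xc 𝔫 (B.Φarch (X.τ₁.dual u ℓ)) =
    (X.P k).ω (X.ιinf B.Γ₀ (X.κ₁ u) * B.κ₂ m, 1) (thinCosetTestFunₗ xc 𝔫 (B.Φarch ℓ))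
  have hmul : ((X.ιinf B.Γ₀ (X.κ₁ u) * B.κ₂ m, 1) : X.GU × relNormOneIdeles X.K X.L) =
      (X.ιinf B.Γ₀ (X.κ₁ u), 1) * (B.κ₂ m, 1) := by
    rw [Prod.mk_mul_mk, mul_one]
  rw [hmul, map_mul, Module.End.mul_apply, B.fixN, B.prodN, B.harm]

/-- theta-equivariance of the family through `κ` and `σ`. -/
theorem isThetaEquivariant_family : (X.P k).kernelDatum.IsThetaEquivariant B.kappa B.sigma B.jFam :=
  (X.P k).kernelDatum.isThetaEquivariant_of_act B.act_family

/-- Level correction (`c := (1, m)` with `m` from `level`). -/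
theorem isLevelCorrected : IsLevelCorrected (X.P k).ΓU B.kappa B.tau (X.ιinf B.Γ₀) (X.Δ B.Γ₀) := by
  intro δ hδ
  obtain ⟨m, hm⟩ := B.level δ hδ
  refine ⟨(1, m), by simp, by simpa using hm, fun g => ?_⟩
  simpa using B.comm m g

/-- Weight matching (`η₁ := inl`). -/
theorem isWeightMatched : IsWeightMatched B.kappa B.tau (X.ιinf B.Γ₀) X.κ₁ X.τ₁ (MonoidHom.inl X.K₁ B.K₂) :=
  ⟨fun u => by simp, fun _ => rfl⟩

/-- **The `K`-type situation of the family at the thin coset.** -/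
def situation : KTypeSituation (X.P k) (X.ιinf B.Γ₀) (X.Δ B.Γ₀) X.κ₁ X.τ₁ where
  Kc := X.K₁ × B.K₂
  κ := B.kappa
  E := Module.Dual ℂ X.W
  σ := B.sigma
  τ := B.tau
  ι := LinearMap.id
  hι := B.tau_dual_apply
  η₁ := MonoidHom.inl X.K₁ B.K₂
  hΔ := B.isLevelCorrected
  hη := B.isWeightMatched
  𝓙 := {⟨B.jFam, B.isThetaEquivariant_family⟩}

/-- (Ported verbatim from the HodgeCMPerL package; no docstring in the source.) -/
@[simp] theorem situation_𝓙 : B.situation.𝓙 = {⟨B.jFam, B.isThetaEquivariant_family⟩} := rfl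

/-- The situation is SATURATED at `K_{Γ₀}` ((Θ-sat): index `(1, m)`, weight `τ₁ 1 = 1`). -/
theorem situation_isSaturated : B.situation.IsSaturated (X.KΓ B.Γ₀) := fun g hg => by
  obtain ⟨m, hm⟩ := B.sat g hg
  refine ⟨(1, m), ?_, ?_⟩
  · change B.kappa (1, m) = g
    rw [kappa_apply, map_one, map_one, one_mul, hm]
  · change B.tau (1, m) = 1
    rw [tau_apply, map_one]

/-- The situation is STRICT (its one family acts on the nose). -/
theorem situation_isStrict : B.situation.IsStrict := by
  intro j hj y e
  rw [situation_𝓙, Set.mem_singleton_iff] at hj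
  subst hj
  exact B.act_family y e

/-- The adelic theta form of the one family against the weight function `f`. -/
def thetaFormOf (f : C(relNormOneIdeles X.K X.L ⧸ relNormOneRat X.K X.L, ℂ)) : weightForms (X.P k).ΓU B.kappa B.tau :=
  (X.P k).kernelDatum.thetaForm (probHaarRelNormOneQuot X.K X.L) (X.P k).kernelDatum_thetaLinear B.kappa
    B.jFam B.isThetaEquivariant_family LinearMap.id B.tau_dual_apply f

/-- The product structure on the `Θ`-initial carrier ((W-⊗′), `s = id`). -/
theorem act_jFam (g : X.G₁) (ℓ : Module.Dual ℂ X.W) :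
    (X.P k).kernelDatum.W.act ((X.P k).kernelDatum.s (X.ιinf B.Γ₀ g, 1)) (B.jFam ℓ) =
      (X.P k).weilDatum.toThetaTop (thinCosetTestFunₗ xc 𝔫 (B.ωinf g (B.Φarch ℓ))) := by
  change (X.P k).ω (X.ιinf B.Γ₀ g, 1) (thinCosetTestFunₗ xc 𝔫 (B.Φarch ℓ)) = _
  exact B.prodN g (B.Φarch ℓ)

variable [IsTopologicalGroup X.GU] [LocallyCompactSpace X.GU] [CompactSpace (X.GU ⧸ (X.P k).ΓU)] in
/-- **KERNEL CHAIN**: the `ℓ`-component of the theta form of the family at `y · ι_∞(g)` is the archimedean theta functional (at the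
thin coset) at `y` of `ω_∞(g) Φ_∞(ℓ)`. -/
theorem apply_thetaFormOf_mul_ιinf (f : C(relNormOneIdeles X.K X.L ⧸ relNormOneRat X.K X.L, ℂ)) (y : X.GU)
    (g : X.G₁) (ℓ : Module.Dual ℂ X.W) :
    ℓ ((B.thetaFormOf f).1 (y * X.ιinf B.Γ₀ g)) = (X.P k).thetaArchFunₗAt xc 𝔫 f y (B.ωinf g (B.Φarch ℓ)) := by
  rw [WeilPairData.thetaArchFunₗAt_apply, ← B.act_jFam g ℓ, ← ThetaKernelDatum.thetaLiftFun_mul_right]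
  exact (X.P k).kernelDatum.apply_thetaForm _ _ _ _ _ _ _ f (y * X.ιinf B.Γ₀ g) ℓ

/-- **(AN)** (verbatim copy of `ArchKTypeData.IsWeaklyPDiff`: it only sees `ωinf`, `Φarch`). -/
def IsWeaklyPDiff {P' : Type*} [NormedAddCommGroup P'] [NormedSpace ℝ P'] (e : P' → X.G₁) : Prop :=
  ∀ (T : 𝓢((X.J → mixedSpace X.K), ℂ) →L[ℂ] ℂ) (ℓ : Module.Dual ℂ X.W),
    DifferentiableAt ℝ (fun b => T (B.ωinf (e b) (B.Φarch ℓ))) 0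

/-- **(REP) along one direction** (verbatim copy of `ArchKTypeData.IsPMinusKilledAlong`). -/
def IsPMinusKilledAlong {P' : Type*} [NormedAddCommGroup P'] [NormedSpace ℝ P'] [Module ℂ P'] (e : P' → X.G₁)
    (v : P') : Prop :=
  ∀ ℓ : Module.Dual ℂ X.W, ∃ D Dᵢ : 𝓢((X.J → mixedSpace X.K), ℂ),
    Tendsto (fun t : ℝ => t⁻¹ • (B.ωinf (e (t • v)) (B.Φarch ℓ) - B.Φarch ℓ)) (𝓝[≠] 0) (𝓝 D) ∧
      Tendsto (fun t : ℝ => t⁻¹ • (B.ωinf (e (t • (Complex.I • v))) (B.Φarch ℓ) - B.Φarch ℓ)) (𝓝[≠] 0)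
        (𝓝 Dᵢ) ∧ D + Complex.I • Dᵢ = 0

/-- **(REP′)** (verbatim copy of `ArchKTypeData.IsWeaklyCR`). -/
def IsWeaklyCR {P' : Type*} [NormedAddCommGroup P'] [NormedSpace ℝ P'] [Module ℂ P'] (e : P' → X.G₁) : Prop :=
  ∀ (T : 𝓢((X.J → mixedSpace X.K), ℂ) →L[ℂ] ℂ) (ℓ : Module.Dual ℂ X.W) (v : P'),
    fderiv ℝ (fun b => T (B.ωinf (e b) (B.Φarch ℓ))) 0 (Complex.I • v) =
      Complex.I • fderiv ℝ (fun b => T (B.ωinf (e b) (B.Φarch ℓ))) 0 v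

/-- the three archimedean predicates of the installed data, read through `toAt`, are the installed ones (`Iff.rfl` × 3). -/
theorem _root_.HodgeCM.Model.ArchKTypeData.toAt_isWeaklyPDiff_iff {N : ℕ} (C : ArchKTypeData X k N)
    {P' : Type*} [NormedAddCommGroup P'] [NormedSpace ℝ P'] (e : P' → X.G₁) :
    C.toAt.IsWeaklyPDiff e ↔ C.IsWeaklyPDiff e := Iff.rfl

/-- (Ported verbatim from the HodgeCMPerL package; no docstring in the source.) -/
theorem _root_.HodgeCM.Model.ArchKTypeData.toAt_isPMinusKilledAlong_iff {N : ℕ} (C : ArchKTypeData X k N)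
    {P' : Type*} [NormedAddCommGroup P'] [NormedSpace ℝ P'] [Module ℂ P'] (e : P' → X.G₁) (v : P') :
    C.toAt.IsPMinusKilledAlong e v ↔ C.IsPMinusKilledAlong e v := Iff.rfl

/-- (Ported verbatim from the HodgeCMPerL package; no docstring in the source.) -/
theorem _root_.HodgeCM.Model.ArchKTypeData.toAt_isWeaklyCR_iff {N : ℕ} (C : ArchKTypeData X k N)
    {P' : Type*} [NormedAddCommGroup P'] [NormedSpace ℝ P'] [Module ℂ P'] (e : P' → X.G₁) :
    C.toAt.IsWeaklyCR e ↔ C.IsWeaklyCR e := Iff.rfl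

/-- **(AN) + (REP) along `c_0 e_0`, `c_1 e_1` ⇒ (REP′)** for a chart `e : ℂ² → G₁` with `e 0 = 1` (same proof as
`ArchKTypeData.isWeaklyCR_of_isPMinusKilledAlong`). -/
theorem isWeaklyCR_of_isPMinusKilledAlong {e : (Fin 2 → ℂ) → X.G₁} (he : e 0 = 1) (hd : B.IsWeaklyPDiff e)
    (cf : Fin 2 → ℂ) (hc : ∀ p, cf p ≠ 0) (hk : ∀ p, B.IsPMinusKilledAlong e (cf p • (Pi.single p 1 : Fin 2 → ℂ))) :
    B.IsWeaklyCR e := by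
  intro T ℓ v
  have h0 : B.ωinf (e 0) (B.Φarch ℓ) = B.Φarch ℓ := by rw [he, map_one, Module.End.one_apply]
  refine ThetaHolDirections.apply_I_smul_of_basis
    ((fderiv ℝ (fun b => T (B.ωinf (e b) (B.Φarch ℓ))) 0).toLinearMap) cf hc (fun p => ?_) v
  obtain ⟨D, Dᵢ, hD, hDᵢ, hsum⟩ := hk p ℓ
  exact ThetaHolAssembly.fderiv_I_smul_of_slopes T (Ψ := fun b => B.ωinf (e b) (B.Φarch ℓ)) (hd T ℓ) _
    (by simpa only [h0] using hD) (by simpa only [h0] using hDᵢ) hsum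


-- port_pkg: scope closed for this part
end ArchKTypeDataAt
end Generic
end Model
end HodgeCM
end
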